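import Mathlib.Geometry.Manifold.Algebra.LieGroup
import Mathlib.Geometry.Manifold.Complex
import Mathlib.Geometry.Manifold.ContMDiff.Atlas
import Mathlib.Topology.Algebra.OpenSubgroup
import HarnessLib

/-!
# Compact connected complex Lie groups are commutative

Topic `Geometry/Kaehler` (complex manifolds); namespace `Literature.Geometry.Kaehler`. One theorem
(with its additive translation), no definition, no named fact.

* `mul_comm_of_compactSpace_of_lieGroup` / `add_comm_of_compactSpace_of_lieAddGroup` — a compact
  connected complex Lie group (`[Group G] [ChartedSpace E G] [LieGroup 𝓘(ℂ, E) ω G]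
  [CompactSpace G] [ConnectedSpace G]`, `E` a complex normed space) is commutative. This is the
  first half of Lange, *Abelian Varieties over the Complex Numbers*, Lemma 1.1.2
  (= Lange–Birkenhake, *Complex Abelian Varieties*, Lemma 1.1.1; Mumford, *Abelian Varieties*,
  §1 (1)), with the proof given there: by compactness (tube lemma,
  `IsCompact.eventually_forall_of_forall_eventually`)
  there is a neighbourhood `W` of `1` such that the commutator `x ↦ x y x⁻¹ y⁻¹` maps `G` into the
  domain of the chart at `1` for every `y ∈ W`; composed with the chart it is a holomorphic map from
  the compact connected `G` to `E`, hence constant (Mathlib's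
  `MDifferentiable.apply_eq_of_compactSpace`), hence `≡ 1`; so the centre of `G` contains `W`, is an
  open subgroup, hence closed, hence all of `G`.

The second half of the lemma (a compact connected commutative complex Lie group is a complex
torus) is `Literature/Geometry/Kaehler/CompactComplexLieGroupTorus.lean`.

## References

* H. Lange, *Abelian Varieties over the Complex Numbers* (2023), Lemma 1.1.2.
  [Lange2023AbelianVarietiesComplex]
* D. Mumford, *Abelian Varieties* (1970), §1 (1). [MumfordAV1970]
-/

noncomputable section

open Set Filter Function
open scoped Topology ContDiff Manifold

namespace Literature.Geometry.Kaehler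

/-- **A compact connected complex Lie group is commutative** (Lange, *Abelian Varieties over the
Complex Numbers*, Lemma 1.1.2, first half; Mumford, *Abelian Varieties*, §1 (1)). Rigidity
argument: for `y` near `1` the commutator `x ↦ x y x⁻¹ y⁻¹` maps the compact connected `G`
holomorphically into one chart domain, where holomorphic maps to `E` are constant
(`MDifferentiable.apply_eq_of_compactSpace`), so it is `≡ 1`; the `y` commuting with everything
form a subgroup containing a neighbourhood of `1`, hence open, hence everything.
[cite: Lange2023AbelianVarietiesComplex, Lemma 1.1.2] -/
theorem mul_comm_of_compactSpace_of_lieGroup (E : Type*) [NormedAddCommGroup E] [NormedSpace ℂ E]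
    {G : Type*} [Group G] [TopologicalSpace G] [ChartedSpace E G] [LieGroup 𝓘(ℂ, E) ω G]
    [CompactSpace G] [ConnectedSpace G] (a b : G) : a * b = b * a := by
  haveI : IsTopologicalGroup G := topologicalGroup_of_lieGroup 𝓘(ℂ, E) ω
  -- the commutator map
  set c : G → G → G := fun x y ↦ x * y * x⁻¹ * y⁻¹ with hc
  have hcont : Continuous (uncurry c) := by
    simp only [hc]
    fun_prop
  -- tube lemma: for `y` near `1`, `c x y` lies in the domain of the chart at `1` for all `x`
  have hW : ∀ᶠ y in 𝓝 (1 : G), ∀ x ∈ (univ : Set G), c x y ∈ (chartAt E (1 : G)).source := by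
    refine isCompact_univ.eventually_forall_of_forall_eventually fun x _ ↦ ?_
    have h1 : c x 1 = 1 := by simp [hc]
    have : Tendsto (fun z : G × G ↦ c z.2 z.1) (𝓝 (1, x)) (𝓝 (c x 1)) :=
      (hcont.comp continuous_swap).continuousAt
    rw [h1] at this
    exact this.eventually_mem ((chartAt E (1 : G)).open_source.mem_nhds (mem_chart_source E 1))
  -- for such `y`, `x ↦ chart (c x y)` is holomorphic on `G`, hence constant
  have hcomm : ∀ᶠ y in 𝓝 (1 : G), ∀ x, c x y = 1 := by
    filter_upwards [hW] with y hy x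
    have hmd : MDifferentiable 𝓘(ℂ, E) 𝓘(ℂ, E) fun x ↦ chartAt E (1 : G) (c x y) := by
      intro x
      have h1 : ContMDiffAt 𝓘(ℂ, E) 𝓘(ℂ, E) ω (fun x ↦ c x y) x := by
        simp only [hc]
        exact ((contMDiffAt_id.mul contMDiffAt_const).mul contMDiffAt_id.inv).mul
          contMDiffAt_const
      have h2 : ContMDiffAt 𝓘(ℂ, E) 𝓘(ℂ, E) ω (chartAt E (1 : G)) (c x y) :=
        (contMDiffOn_chart (x := (1 : G))).contMDiffAt
          ((chartAt E (1 : G)).open_source.mem_nhds (hy x (mem_univ x)))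
      exact (h2.comp x h1).mdifferentiableAt (by simp)
    have key := hmd.apply_eq_of_compactSpace x 1
    have hc1 : c 1 y = 1 := by simp [hc]
    rw [hc1] at key
    exact (chartAt E (1 : G)).injOn (hy x (mem_univ x)) (mem_chart_source E 1) key
  -- the centre contains a neighbourhood of `1`, hence is everything
  have hZ : (Subgroup.center G : Set G) ∈ 𝓝 (1 : G) := by
    filter_upwards [hcomm] with y hy
    rw [SetLike.mem_coe, Subgroup.mem_center_iff]
    intro x
    have := hy x
    simp only [hc] at this
    calc x * y = x * y * x⁻¹ * y⁻¹ * y * x := by group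
      _ = y * x := by rw [this, one_mul]
  have hopen : IsOpen (Subgroup.center G : Set G) := Subgroup.isOpen_of_mem_nhds _ hZ
  have hclosed : IsClosed (Subgroup.center G : Set G) :=
    (Subgroup.center G).isClosed_of_isOpen hopen
  have huniv : (Subgroup.center G : Set G) = univ :=
    IsClopen.eq_univ ⟨hclosed, hopen⟩ ⟨1, (Subgroup.center G).one_mem⟩
  have hb : b ∈ Subgroup.center G := by
    rw [← SetLike.mem_coe, huniv]; trivial
  exact (Subgroup.mem_center_iff.1 hb) a

/-- **A compact connected complex (additive) Lie group is commutative** — the additive form of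
`mul_comm_of_compactSpace_of_lieGroup` (Lange, *Abelian Varieties over the Complex Numbers*,
Lemma 1.1.2, first half; Mumford, *Abelian Varieties*, §1 (1)), same rigidity proof with the
commutator `x ↦ x + y - x - y`. [cite: Lange2023AbelianVarietiesComplex, Lemma 1.1.2] -/
theorem add_comm_of_compactSpace_of_lieAddGroup (E : Type*) [NormedAddCommGroup E]
    [NormedSpace ℂ E] {G : Type*} [AddGroup G] [TopologicalSpace G] [ChartedSpace E G]
    [LieAddGroup 𝓘(ℂ, E) ω G] [CompactSpace G] [ConnectedSpace G] (a b : G) : a + b = b + a := by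
  haveI : IsTopologicalAddGroup G := topologicalAddGroup_of_lieAddGroup 𝓘(ℂ, E) ω
  set c : G → G → G := fun x y ↦ x + y + -x + -y with hc
  have hcont : Continuous (uncurry c) := by
    simp only [hc]
    fun_prop
  have hW : ∀ᶠ y in 𝓝 (0 : G), ∀ x ∈ (univ : Set G), c x y ∈ (chartAt E (0 : G)).source := by
    refine isCompact_univ.eventually_forall_of_forall_eventually fun x _ ↦ ?_
    have h1 : c x 0 = 0 := by simp [hc]
    have : Tendsto (fun z : G × G ↦ c z.2 z.1) (𝓝 (0, x)) (𝓝 (c x 0)) :=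
      (hcont.comp continuous_swap).continuousAt
    rw [h1] at this
    exact this.eventually_mem ((chartAt E (0 : G)).open_source.mem_nhds (mem_chart_source E 0))
  have hcomm : ∀ᶠ y in 𝓝 (0 : G), ∀ x, c x y = 0 := by
    filter_upwards [hW] with y hy x
    have hmd : MDifferentiable 𝓘(ℂ, E) 𝓘(ℂ, E) fun x ↦ chartAt E (0 : G) (c x y) := by
      intro x
      have h1 : ContMDiffAt 𝓘(ℂ, E) 𝓘(ℂ, E) ω (fun x ↦ c x y) x := by
        simp only [hc]
        exact ((contMDiffAt_id.add contMDiffAt_const).add contMDiffAt_id.neg).add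
          contMDiffAt_const
      have h2 : ContMDiffAt 𝓘(ℂ, E) 𝓘(ℂ, E) ω (chartAt E (0 : G)) (c x y) :=
        (contMDiffOn_chart (x := (0 : G))).contMDiffAt
          ((chartAt E (0 : G)).open_source.mem_nhds (hy x (mem_univ x)))
      exact (h2.comp x h1).mdifferentiableAt (by simp)
    have key := hmd.apply_eq_of_compactSpace x 0
    have hc1 : c 0 y = 0 := by simp [hc]
    rw [hc1] at key
    exact (chartAt E (0 : G)).injOn (hy x (mem_univ x)) (mem_chart_source E 0) key
  have hZ : (AddSubgroup.center G : Set G) ∈ 𝓝 (0 : G) := by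
    filter_upwards [hcomm] with y hy
    rw [SetLike.mem_coe, AddSubgroup.mem_center_iff]
    intro x
    have := hy x
    simp only [hc] at this
    calc x + y = x + y + -x + -y + y + x := by rw [neg_add_cancel_right, neg_add_cancel_right]
      _ = y + x := by rw [this, zero_add]
  have hopen : IsOpen (AddSubgroup.center G : Set G) := AddSubgroup.isOpen_of_mem_nhds _ hZ
  have hclosed : IsClosed (AddSubgroup.center G : Set G) :=
    (AddSubgroup.center G).isClosed_of_isOpen hopen
  have huniv : (AddSubgroup.center G : Set G) = univ :=
    IsClopen.eq_univ ⟨hclosed, hopen⟩ ⟨0, (AddSubgroup.center G).zero_mem⟩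
  have hb : b ∈ AddSubgroup.center G := by
    rw [← SetLike.mem_coe, huniv]; trivial
  exact (AddSubgroup.mem_center_iff.1 hb) a

end Literature.Geometry.Kaehler
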